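import Summits.BirchSwinnertonDyer.Rank1Residual.GaloisImage.PadicRootCensus
import Summits.BirchSwinnertonDyer.Rank1Residual.GaloisImage.LocalThreeTorsionCount
import Summits.BirchSwinnertonDyer.Rank1Residual.GaloisImage.PadicRootCensusRoots
import Summits.BirchSwinnertonDyer.Rank1Residual.GaloisImage.PadicThreeSquareClass
import Literature.NumberTheory.EllipticCurves.GlobalMinimalModel
import HarnessLib

/-!
# KERNEL DECIDER for the local `3`-torsion count `#E(ℚ₃)[3] = 3^t` from the integer
# `a`-invariants and a `decide`-checked certificate (team n1011, row T-LOC3T, FILE C2)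

HONEST FRAMING (cell `b2b-bsdres`, run/shared/lean/b2b/bsd-rank1-residual/, verbatim in every
file): the goal of the cell is to DELETE the COMBINATION-SHAPED residual classes of the
Birch–Swinnerton-Dyer formula for ALL analytic-rank `≤ 1` elliptic curves over `ℚ` — "full BSD
formula for every rank `≤ 1` curve in class `C`" assembled STRICTLY from published theorems — so
that the rank-`≤ 1` remainder becomes exactly the CONSTRUCTION-SHAPED classes, which are TYPED
(missing-input `Prop`s), NOT attempted. This is not "finishing BSD". Team n1011 (N10/N11, route
(a) at `p = 3`): research route; this file is a TOOL; nothing is booked by it; no mark / label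
moved; X4 stays CONSTRUCTION-SHAPED. No named fact, no `sorry`; the only definitions are the
COMPUTABLE certificate checker `threeTorsionCheck` and its bookkeeping lists.

## What

Route 1's records (`Assembly.padicValRat_le_of_certificate_of_transport`,
`GaloisImage/KuriharaLowerBoundThreeOfTransport.lean`; `KolyvaginLevelOneUnitCaseOf*`;
`KolyvaginLevelOneTorsionCorner`) carry the ROW binder
`ht : Nat.card {Q : (W.baseChange ℚ_[3]).toAffine.Point // (3 : ℕ) • Q = 0} = 3 ^ t`, so far an
EVIDENCE column (census job j132295, PARI). r1 ROUTE-1 §27.2: "a kernel decider = Hensel +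
reduction lemma is NOT on file". THIS FILE is that decider:

* `threeTorsionCheck a₁ a₂ a₃ a₄ a₆ k cert : Option ℕ` (integer arithmetic only) runs FILE A's
  root census (`RootCensus.check₂`, with the Taylor exclusion test of FILE A1b — needed on
  potentially multiplicative rows, where `Ψ₃`'s cubic factor has near-roots) for `Ψ₃ ∈ ℤ[X]` at
  precision `k` on the certificate
  `cert : List (ℤ × ℕ × ℕ × ℕ)` of entries `(c, m, N, w)` (approximate root `c`,
  `m = v₃(Ψ₃′(c))`, `3^N ∣ Ψ₃(c)`, `w = v₃(g(c))`, `w + 1 + m ≤ N`) and returns the number `S` of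
  entries whose `g(c) = 4c³ + b₂c² + 2b₄c + b₆` is `3^w·u` with `w` even and `u ≡ 1 (mod 3)`.
* **`natCard_threeTorsion_eq_of_check`** (and `…_of_intModel_of_check`, route 1's
  `integralModelInt` currency): if the check returns `some S` (and `Δ ≠ 0`) then
  `Nat.card {Q : ((⟨a₁,a₂,a₃,a₄,a₆⟩ : WeierstrassCurve ℚ).baseChange ℚ_[3]).toAffine.Point //
  (3 : ℕ) • Q = 0} = 1 + 2 * S`; consumer shapes `…_eq_three_pow_zero_of_check` (`S = 0`),
  `…_eq_three_pow_one_of_check` (`S = 1`) in EXACTLY the `ht` currency.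
* Mathematics: FILE B (`x`-coordinates of `3`-torsion points are `3`-adic integers;
  `#E(ℚ₃)[3] = 1 + Σ_{roots x of Ψ₃ in ℤ₃} #{y}`; `#{y} ∈ {0, 2}` by the square class of `g(x)`),
  FILE A (the roots of `Ψ₃` in `ℤ₃` are exactly the certified Hensel roots `zᵢ ≡ cᵢ
  (mod 3^{Nᵢ-mᵢ})`), and the square class of `g(zᵢ)` read at `cᵢ`
  (`isSquare_intCast_padic_three_iff`: an integer `3^w u`, `3 ∤ u`, is a square in `ℚ₃` iff `w`
  is even and `u ≡ 1 (mod 3)` — Serre, *Cours d'arithmétique* II §3.3 — transported along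
  `‖g(zᵢ) - g(cᵢ)‖ ≤ 3⁻¹‖g(cᵢ)‖`).
* INSTANCES (FILE C3 `LocalThreeTorsionRecords`, by `decide +kernel`): the EXOTIC `t = 1` cells
  388800ha1 / 388800ij1, 124848bb1 (`t = 1`), 5400bu1 / 114264m1 (`t = 0`); EVIDENCE cross-check:
  p14's census column j132295 agrees with the Python mirror of `threeTorsionCheck` on all 341
  `m = 3` cells of its list (271 × `#E(ℚ₃)[3] = 1`, 70 × `= 3`).

References: [SilvermanAEC2009] Ex. 3.7, VII.3; [Serre1973] Ch. II §3.3; Hensel's lemma (Mathlib).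
-/

set_option autoImplicit false

noncomputable section

open scoped Classical
open Polynomial WeierstrassCurve
open Summit.BirchSwinnertonDyer.Rank1Residual.GaloisImage.RootCensus

namespace Summit.BirchSwinnertonDyer.Rank1Residual.GaloisImage.LocalTorsion3

/-! ### The checker -/

/-- The integer `b`-invariants `(b₂, b₄, b₆, b₈)`. [folklore] -/
def bInvs (a₁ a₂ a₃ a₄ a₆ : ℤ) : ℤ × ℤ × ℤ × ℤ :=
  (a₁ ^ 2 + 4 * a₂, 2 * a₄ + a₁ * a₃, a₃ ^ 2 + 4 * a₆,
    a₁ ^ 2 * a₆ + 4 * a₂ * a₆ - a₁ * a₃ * a₄ + a₂ * a₃ ^ 2 - a₄ ^ 2)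

/-- Ascending coefficient list of `Ψ₃ = 3X⁴ + b₂X³ + 3b₄X² + 3b₆X + b₈`. [folklore] -/
def psi3List (a₁ a₂ a₃ a₄ a₆ : ℤ) : List ℤ :=
  let b := bInvs a₁ a₂ a₃ a₄ a₆
  [b.2.2.2, 3 * b.2.2.1, 3 * b.2.1, b.1, 3]

/-- Ascending coefficient list of `g = 4X³ + b₂X² + 2b₄X + b₆`. [folklore] -/
def gList (a₁ a₂ a₃ a₄ a₆ : ℤ) : List ℤ :=
  let b := bInvs a₁ a₂ a₃ a₄ a₆
  [b.2.2.1, 2 * b.2.1, b.1, 4]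

/-- Square flag of an integer `n = 3^w u`: `w` even and `u ≡ 1 (mod 3)`. [folklore] -/
def sqFlag (n : ℤ) (w : ℕ) : Bool :=
  (w % 2 == 0) && ((n / 3 ^ w) % 3 == 1)

/-- Per-entry `g`-data check for `(c, m, N, w)`: `3^w ∣ g(c)`, `3^{w+1} ∤ g(c)`, `w + 1 + m ≤ N`.
[folklore] -/
def gEntryOK (lg : List ℤ) (e : ℤ × ℕ × ℕ × ℕ) : Bool :=
  (evalList lg e.1 % (3 : ℤ) ^ e.2.2.2 == 0) && !(evalList lg e.1 % (3 : ℤ) ^ (e.2.2.2 + 1) == 0) &&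
    decide (e.2.2.2 + 1 + e.2.1 ≤ e.2.2.1)

/-- Forget the `w`-slot of an entry (FILE A's certificate format). [folklore] -/
def toRootEntry (e : ℤ × ℕ × ℕ × ℕ) : ℤ × ℕ × ℕ := (e.1, e.2.1, e.2.2.1)

/-- **The checker.** `some S` iff FILE A's root census (`check₂`) of `Ψ₃` succeeds at
precision `k` on the balls of `cert` and every entry's `g`-data checks; `S` = number of entries
with a square `g`.
[folklore] -/
def threeTorsionCheck (a₁ a₂ a₃ a₄ a₆ : ℤ) (k : ℕ) (cert : List (ℤ × ℕ × ℕ × ℕ)) : Option ℕ :=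
  if check₂ 3 (psi3List a₁ a₂ a₃ a₄ a₆) k (cert.map toRootEntry) &&
      cert.all (gEntryOK (gList a₁ a₂ a₃ a₄ a₆))
  then some (cert.countP fun e => sqFlag (evalList (gList a₁ a₂ a₃ a₄ a₆) e.1) e.2.2.2)
  else none

/-! ### The decider theorem -/

section Main

variable (a₁ a₂ a₃ a₄ a₆ : ℤ)

/-- The curve over `ℚ₃`. -/
private abbrev E3 : WeierstrassCurve ℚ_[3] :=
  ((⟨a₁, a₂, a₃, a₄, a₆⟩ : WeierstrassCurve ℚ).baseChange ℚ_[3])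

/-- The curve over `ℚ₃` has the cast integer coefficients. -/
private theorem E3_eq : E3 a₁ a₂ a₃ a₄ a₆ =
    ⟨(a₁ : ℚ_[3]), (a₂ : ℚ_[3]), (a₃ : ℚ_[3]), (a₄ : ℚ_[3]), (a₆ : ℚ_[3])⟩ := by
  ext <;> simp [E3, WeierstrassCurve.baseChange, WeierstrassCurve.map]

/-- The curve over `ℚ₃` has `3`-integral coefficients. -/
private instance E3_isIntegral : (E3 a₁ a₂ a₃ a₄ a₆).IsIntegral ℤ_[3] := by
  rw [E3_eq]
  exact ⟨⟨(a₁ : ℤ_[3]), (a₂ : ℤ_[3]), (a₃ : ℤ_[3]), (a₄ : ℤ_[3]), (a₆ : ℤ_[3])⟩,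
    by ext <;> simp [WeierstrassCurve.baseChange, WeierstrassCurve.map]⟩

/-- The discriminant over `ℚ₃` is the cast of the integer discriminant. -/
private theorem E3_Δ : (E3 a₁ a₂ a₃ a₄ a₆).Δ =
    (((⟨a₁, a₂, a₃, a₄, a₆⟩ : WeierstrassCurve ℤ).Δ : ℤ) : ℚ_[3]) := by
  have : E3 a₁ a₂ a₃ a₄ a₆ =
      (⟨a₁, a₂, a₃, a₄, a₆⟩ : WeierstrassCurve ℤ).map (Int.castRingHom ℚ_[3]) := by
    rw [E3_eq]; ext <;> simp [WeierstrassCurve.map]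
  rw [this, WeierstrassCurve.map_Δ]; simp

/-- `Ψ₃` of the curve, evaluated at a `3`-adic integer, is FILE A's integer polynomial. -/
private theorem eval_Ψ₃_eq_aeval (z : ℤ_[3]) :
    (E3 a₁ a₂ a₃ a₄ a₆).Ψ₃.eval (z : ℚ_[3]) =
      ((aeval z (ofList (psi3List a₁ a₂ a₃ a₄ a₆)) : ℤ_[3]) : ℚ_[3]) := by
  rw [coe_aeval_ofList, Additive.eval_psi3_eq, E3_eq]
  simp only [psi3List, bInvs, aeval_ofList_cons, aeval_ofList_nil,
    WeierstrassCurve.b₂, WeierstrassCurve.b₄, WeierstrassCurve.b₆, WeierstrassCurve.b₈]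
  push_cast
  ring

/-- `g` of the curve, evaluated at a `3`-adic integer, is the integer polynomial `gList`. -/
private theorem g_eq_aeval (z : ℤ_[3]) :
    4 * (z : ℚ_[3]) ^ 3 + (E3 a₁ a₂ a₃ a₄ a₆).b₂ * (z : ℚ_[3]) ^ 2 +
        2 * (E3 a₁ a₂ a₃ a₄ a₆).b₄ * (z : ℚ_[3]) + (E3 a₁ a₂ a₃ a₄ a₆).b₆ =
      ((aeval z (ofList (gList a₁ a₂ a₃ a₄ a₆)) : ℤ_[3]) : ℚ_[3]) := by
  rw [coe_aeval_ofList, E3_eq]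
  simp only [gList, bInvs, aeval_ofList_cons, aeval_ofList_nil,
    WeierstrassCurve.b₂, WeierstrassCurve.b₄, WeierstrassCurve.b₆]
  push_cast
  ring

/-- `(l.map f)`-sums over `Fin l.length`. [folklore] -/
private theorem sum_fin_eq_sum_map {α : Type*} (l : List α) (f : α → ℕ) :
    ∑ i : Fin l.length, f (l.get i) = (l.map f).sum := by
  rw [← List.sum_ofFn]
  congr 1
  rw [show (fun i => f (l.get i)) = f ∘ l.get from rfl, ← List.map_ofFn, List.ofFn_get]

/-- `Σ (if b then 2 else 0) = 2 · countP`. [folklore] -/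
private theorem sum_map_ite_eq_two_mul_countP {α : Type*} (l : List α) (P : α → Bool) :
    (l.map fun a => if P a then 2 else 0).sum = 2 * l.countP P := by
  induction l with
  | nil => simp
  | cons a l ih =>
    simp only [List.map_cons, List.sum_cons, ih, List.countP_cons]
    by_cases h : P a <;> simp [h]; ring

/-- **THE DECIDER.** If `threeTorsionCheck a₁ a₂ a₃ a₄ a₆ k cert = some S` and `Δ ≠ 0`, then the
number of `ℚ₃`-rational points `Q` of `E : y² + a₁xy + a₃y = x³ + a₂x² + a₄x + a₆` with `3Q = O`
is `1 + 2S`. [folklore] -/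
theorem natCard_threeTorsion_eq_of_check
    (hΔ : (⟨a₁, a₂, a₃, a₄, a₆⟩ : WeierstrassCurve ℤ).Δ ≠ 0) {k S : ℕ}
    {cert : List (ℤ × ℕ × ℕ × ℕ)} (h : threeTorsionCheck a₁ a₂ a₃ a₄ a₆ k cert = some S) :
    Nat.card {Q : ((⟨a₁, a₂, a₃, a₄, a₆⟩ : WeierstrassCurve ℚ).baseChange ℚ_[3]).toAffine.Point //
      (3 : ℕ) • Q = 0} = 1 + 2 * S := by
  -- unpack the checker
  unfold threeTorsionCheck at h
  split_ifs at h with hc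
  simp only [Option.some.injEq] at h
  rw [Bool.and_eq_true, List.all_eq_true] at hc
  obtain ⟨hcheck, hg⟩ := hc
  subst h
  -- the curve
  set E := E3 a₁ a₂ a₃ a₄ a₆ with hEdef
  change Nat.card {Q : E.toAffine.Point // (3 : ℕ) • Q = 0} = _
  haveI : E.IsElliptic := by
    refine ⟨isUnit_iff_ne_zero.mpr ?_⟩
    rw [hEdef, E3_Δ]; exact_mod_cast hΔ
  have h2 : (2 : ℚ_[3]) ≠ 0 := by norm_num
  -- FILE A: the roots of `Ψ₃` in `ℤ₃`
  set l := psi3List a₁ a₂ a₃ a₄ a₆ with hl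
  set lg := gList a₁ a₂ a₃ a₄ a₆ with hlg
  set rc := cert.map toRootEntry with hrc
  obtain ⟨ρ, hinj, hρ, hcomplete⟩ := exists_roots_of_check₂ (p := 3) l k rc hcheck
  have hlen : rc.length = cert.length := by rw [hrc, List.length_map]
  -- index bookkeeping between `rc` and `cert`
  have hget : ∀ i : Fin rc.length, rc.get i = toRootEntry (cert.get (Fin.cast hlen i)) := by
    intro i; simp [hrc, List.getElem_map, Fin.cast]
  -- Step 1: torsion points ↔ (x, y) with `E(x,y)` and `Ψ₃(x) = 0`
  let S' := {xy : ℚ_[3] × ℚ_[3] // E.toAffine.Equation xy.1 xy.2 ∧ E.Ψ₃.eval xy.1 = 0}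
  have e1 : {Q : E.toAffine.Point // (3 : ℕ) • Q = 0} ≃ WithZero S' := by
    refine (Affine.nonsingularPointEquivSubtype (p := fun Q => (3 : ℕ) • Q = 0)
      (show (3 : ℕ) • (0 : E.toAffine.Point) = 0 from nsmul_zero 3)).trans
      (Equiv.optionCongr (Equiv.subtypeEquivRight fun xy => ?_))
    constructor
    · rintro ⟨hns, h3⟩
      exact ⟨hns.left, (three_nsmul_some_eq_zero_iff_eval_Ψ₃ E hns).mp h3⟩
    · rintro ⟨heq, hΨ⟩
      have hns : E.toAffine.Nonsingular xy.1 xy.2 := (Affine.equation_iff_nonsingular).mp heq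
      exact ⟨hns, (three_nsmul_some_eq_zero_iff_eval_Ψ₃ E hns).mpr hΨ⟩
  -- Step 2: `S' ≃ Σ i, {y // E(ρ i, y)}`
  have hxint : ∀ s : S', ‖s.1.1‖ ≤ 1 := by
    rintro ⟨⟨x, y⟩, heq, hΨ⟩
    have hns : E.toAffine.Nonsingular x y := (Affine.equation_iff_nonsingular).mp heq
    exact norm_le_one_of_three_nsmul_eq_zero E hns
      ((three_nsmul_some_eq_zero_iff_eval_Ψ₃ E hns).mpr hΨ)
  have hroot : ∀ s : S', ∃ i, ((ρ i : ℤ_[3]) : ℚ_[3]) = s.1.1 := by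
    intro s
    set zs : ℤ_[3] := ⟨s.1.1, hxint s⟩ with hzs
    have hzs' : (zs : ℚ_[3]) = s.1.1 := rfl
    obtain ⟨i, hi⟩ := hcomplete zs (by
      have h1 := eval_Ψ₃_eq_aeval a₁ a₂ a₃ a₄ a₆ zs
      rw [← hEdef, hzs'] at h1
      have : ((aeval zs (ofList l) : ℤ_[3]) : ℚ_[3]) = 0 := by rw [← h1]; exact s.2.2
      exact PadicInt.coe_eq_zero.mp this)
    exact ⟨i, by rw [hi]⟩
  have hρroot : ∀ i, E.Ψ₃.eval ((ρ i : ℤ_[3]) : ℚ_[3]) = 0 := by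
    intro i; rw [hEdef, eval_Ψ₃_eq_aeval, (hρ i).1]; rfl
  let F : Fin rc.length → Type :=
    fun i => {y : ℚ_[3] // E.toAffine.Equation ((ρ i : ℤ_[3]) : ℚ_[3]) y}
  have e2 : S' ≃ Σ i, F i :=
    { toFun := fun s => ⟨Classical.choose (hroot s), ⟨s.1.2, by
        rw [Classical.choose_spec (hroot s)]; exact s.2.1⟩⟩
      invFun := fun s => ⟨(((ρ s.1 : ℤ_[3]) : ℚ_[3]), s.2.1), s.2.2, hρroot s.1⟩
      left_inv := by
        rintro ⟨⟨x, y⟩, heq, hΨ⟩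
        have := Classical.choose_spec (hroot ⟨⟨x, y⟩, heq, hΨ⟩)
        apply Subtype.ext; apply Prod.ext
        · exact this
        · rfl
      right_inv := by
        rintro ⟨i, y, hy⟩
        have hspec := Classical.choose_spec (hroot ⟨(((ρ i : ℤ_[3]) : ℚ_[3]), y), hy, hρroot i⟩)
        have hi : Classical.choose (hroot ⟨(((ρ i : ℤ_[3]) : ℚ_[3]), y), hy, hρroot i⟩) = i :=
          hinj (Subtype.ext hspec)
        exact Sigma.subtype_ext hi rfl }
  -- Step 3: per-index fibre counts from the square class of `g`
  have hfib : ∀ i : Fin rc.length, Nat.card (F i) =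
      if sqFlag (evalList lg (cert.get (Fin.cast hlen i)).1) (cert.get (Fin.cast hlen i)).2.2.2
      then 2 else 0 := by
    intro i
    -- the precision of the Hensel root
    have hprec := (hρ i).2.2
    rw [hget i] at hprec
    simp only [toRootEntry] at hprec
    set e := cert.get (Fin.cast hlen i) with he
    obtain ⟨hw, hw', hN⟩ : (3 : ℤ) ^ e.2.2.2 ∣ evalList lg e.1 ∧
        ¬ (3 : ℤ) ^ (e.2.2.2 + 1) ∣ evalList lg e.1 ∧ e.2.2.2 + 1 + e.2.1 ≤ e.2.2.1 := by
      have := hg e (List.get_mem cert _)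
      simp only [gEntryOK, Bool.and_eq_true, beq_iff_eq, Bool.not_eq_true', beq_eq_false_iff_ne,
        ne_eq, emod_eq_zero_iff_dvd', decide_eq_true_eq] at this
      exact ⟨this.1.1, this.1.2, this.2⟩
    -- the `g`-values
    set z := ρ i with hz
    set gc : ℤ := evalList lg e.1 with hgc
    have hgc0 : (gc : ℚ_[3]) ≠ 0 := by
      have : gc ≠ 0 := by rintro h0; rw [h0] at hw'; exact hw' (dvd_zero _)
      exact_mod_cast this
    have hgcn : ‖(gc : ℚ_[3])‖ = (3 : ℝ) ^ (-(e.2.2.2 : ℤ)) := norm_intCast_padic_eq hw hw'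
    have hG := g_eq_aeval a₁ a₂ a₃ a₄ a₆ z
    rw [← hEdef] at hG
    -- `‖g(z) - g(c)‖ ≤ ‖z - c‖ ≤ 3^{-(N - m)} ≤ 3^{-(w+1)} = 3⁻¹ ‖g(c)‖`
    have hdist :
        ‖((aeval z (ofList lg) : ℤ_[3]) : ℚ_[3]) - (gc : ℚ_[3])‖ ≤ 3⁻¹ * ‖(gc : ℚ_[3])‖ := by
      have h1 := padic_polynomial_dist (ofList lg) z (e.1 : ℤ_[3])
      rw [aeval_intCast_ofList] at h1
      rw [hgcn, ← PadicInt.coe_intCast, ← PadicInt.coe_sub, ← PadicInt.norm_def]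
      refine (h1.trans hprec).trans ?_
      rw [← zpow_neg_one, ← zpow_add₀ (by norm_num)]
      have hmN : e.2.1 ≤ e.2.2.1 := by omega
      exact zpow_le_zpow_right₀ (by norm_num) (by push_cast [Nat.cast_sub hmN]; omega)
    obtain ⟨hG0, hGsq⟩ := isSquare_iff_of_norm_sub_le hgc0 hdist
    have hsq := isSquare_intCast_padic_three_iff gc e.2.2.2 hw hw'
    by_cases hflag : sqFlag gc e.2.2.2 = true
    · rw [if_pos hflag]
      have : IsSquare (gc : ℚ_[3]) := by
        rw [hsq]; simpa [sqFlag, Bool.and_eq_true, beq_iff_eq, decide_eq_true_eq] using hflag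
      refine natCard_fibre_eq_two E h2 _ ?_ ?_
      · rw [hG]; exact hGsq.mpr this
      · rw [hG]; exact hG0
    · rw [if_neg hflag]
      have : ¬ IsSquare (gc : ℚ_[3]) := by
        rw [hsq]; simpa [sqFlag, Bool.and_eq_true, beq_iff_eq, decide_eq_true_eq] using hflag
      refine natCard_fibre_eq_zero E h2 _ ?_
      rw [hG]; exact fun hs => this (hGsq.mp hs)
  -- Step 4: count
  haveI : ∀ i, Finite (F i) := fun i => finite_fibre E h2 _
  haveI : Finite S' := Finite.of_equiv _ e2.symm
  haveI : Fintype S' := Fintype.ofFinite S'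
  rw [Nat.card_congr e1, show Nat.card (WithZero S') = Nat.card (Option S') from rfl,
    Nat.card_eq_fintype_card, Fintype.card_option, ← Nat.card_eq_fintype_card, Nat.card_congr e2,
    Nat.card_sigma, add_comm]
  congr 1
  -- reindex over `cert`
  let f : ℤ × ℕ × ℕ × ℕ → ℕ := fun e => if sqFlag (evalList lg e.1) e.2.2.2 then 2 else 0
  calc ∑ i, Nat.card (F i) = ∑ i : Fin rc.length, f (cert.get (Fin.cast hlen i)) :=
        Finset.sum_congr rfl fun i _ => hfib i
    _ = ∑ i : Fin cert.length, f (cert.get i) :=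
        Fintype.sum_equiv (finCongr hlen) _ _ (fun i => rfl)
    _ = (cert.map f).sum := sum_fin_eq_sum_map cert f
    _ = 2 * cert.countP (fun e => sqFlag (evalList lg e.1) e.2.2.2) :=
        sum_map_ite_eq_two_mul_countP cert _

/-- Consumer shape `t = 0`: `#E(ℚ₃)[3] = 3 ^ 0`. [folklore] -/
theorem natCard_threeTorsion_eq_three_pow_zero_of_check
    (hΔ : (⟨a₁, a₂, a₃, a₄, a₆⟩ : WeierstrassCurve ℤ).Δ ≠ 0) {k : ℕ}
    {cert : List (ℤ × ℕ × ℕ × ℕ)} (h : threeTorsionCheck a₁ a₂ a₃ a₄ a₆ k cert = some 0) :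
    Nat.card {Q : ((⟨a₁, a₂, a₃, a₄, a₆⟩ : WeierstrassCurve ℚ).baseChange ℚ_[3]).toAffine.Point //
      (3 : ℕ) • Q = 0} = 3 ^ 0 := by
  rw [natCard_threeTorsion_eq_of_check a₁ a₂ a₃ a₄ a₆ hΔ h]; norm_num

/-- Consumer shape `t = 1`: `#E(ℚ₃)[3] = 3 ^ 1`. [folklore] -/
theorem natCard_threeTorsion_eq_three_pow_one_of_check
    (hΔ : (⟨a₁, a₂, a₃, a₄, a₆⟩ : WeierstrassCurve ℤ).Δ ≠ 0) {k : ℕ}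
    {cert : List (ℤ × ℕ × ℕ × ℕ)} (h : threeTorsionCheck a₁ a₂ a₃ a₄ a₆ k cert = some 1) :
    Nat.card {Q : ((⟨a₁, a₂, a₃, a₄, a₆⟩ : WeierstrassCurve ℚ).baseChange ℚ_[3]).toAffine.Point //
      (3 : ℕ) • Q = 0} = 3 ^ 1 := by
  rw [natCard_threeTorsion_eq_of_check a₁ a₂ a₃ a₄ a₆ hΔ h]; norm_num

/-! ### Consumer shapes in route 1's `integralModelInt` currency (R1-54) -/

/-- If the globally minimal integer model of `W/ℚ` is `⟨a₁, …, a₆⟩` then `W` is that model read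
in `ℚ`, and its integer discriminant is non-zero. -/
private theorem eq_and_Δ_ne_zero_of_intModel (W : WeierstrassCurve ℚ) [W.IsElliptic]
    [W.IsGloballyMinimal] (hI : W.integralModelInt = ⟨a₁, a₂, a₃, a₄, a₆⟩) :
    W = (⟨a₁, a₂, a₃, a₄, a₆⟩ : WeierstrassCurve ℚ) ∧
      (⟨a₁, a₂, a₃, a₄, a₆⟩ : WeierstrassCurve ℤ).Δ ≠ 0 := by
  have hW := W.map_integralModelInt
  rw [hI] at hW
  refine ⟨by rw [← hW]; ext <;> simp [WeierstrassCurve.map], fun h0 => ?_⟩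
  have hΔ : W.Δ = (((⟨a₁, a₂, a₃, a₄, a₆⟩ : WeierstrassCurve ℤ).Δ : ℤ) : ℚ) := by
    rw [← hW, WeierstrassCurve.map_Δ]; simp
  rw [h0, Int.cast_zero] at hΔ
  exact W.isUnit_Δ.ne_zero hΔ

/-- **THE DECIDER, `integralModelInt` currency**: for `W/ℚ` globally minimal with integer model
`⟨a₁, …, a₆⟩`, `threeTorsionCheck a₁ … a₆ k cert = some S` gives `#E(ℚ₃)[3] = 1 + 2S`. [folklore] -/
theorem natCard_threeTorsion_eq_of_intModel_of_check (W : WeierstrassCurve ℚ) [W.IsElliptic]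
    [W.IsGloballyMinimal] (hI : W.integralModelInt = ⟨a₁, a₂, a₃, a₄, a₆⟩) {k S : ℕ}
    {cert : List (ℤ × ℕ × ℕ × ℕ)} (h : threeTorsionCheck a₁ a₂ a₃ a₄ a₆ k cert = some S) :
    Nat.card {Q : (W.baseChange ℚ_[3]).toAffine.Point // (3 : ℕ) • Q = 0} = 1 + 2 * S := by
  obtain ⟨hW, hΔ⟩ := eq_and_Δ_ne_zero_of_intModel a₁ a₂ a₃ a₄ a₆ W hI
  rw [hW]
  exact natCard_threeTorsion_eq_of_check a₁ a₂ a₃ a₄ a₆ hΔ h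

/-- `integralModelInt` currency, `t = 0`: `#E(ℚ₃)[3] = 3 ^ 0`. [folklore] -/
theorem natCard_threeTorsion_eq_three_pow_zero_of_intModel_of_check (W : WeierstrassCurve ℚ)
    [W.IsElliptic] [W.IsGloballyMinimal] (hI : W.integralModelInt = ⟨a₁, a₂, a₃, a₄, a₆⟩)
    {k : ℕ} {cert : List (ℤ × ℕ × ℕ × ℕ)}
    (h : threeTorsionCheck a₁ a₂ a₃ a₄ a₆ k cert = some 0) :
    Nat.card {Q : (W.baseChange ℚ_[3]).toAffine.Point // (3 : ℕ) • Q = 0} = 3 ^ 0 := by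
  rw [natCard_threeTorsion_eq_of_intModel_of_check a₁ a₂ a₃ a₄ a₆ W hI h]; norm_num

/-- `integralModelInt` currency, `t = 1`: `#E(ℚ₃)[3] = 3 ^ 1`. [folklore] -/
theorem natCard_threeTorsion_eq_three_pow_one_of_intModel_of_check (W : WeierstrassCurve ℚ)
    [W.IsElliptic] [W.IsGloballyMinimal] (hI : W.integralModelInt = ⟨a₁, a₂, a₃, a₄, a₆⟩)
    {k : ℕ} {cert : List (ℤ × ℕ × ℕ × ℕ)}
    (h : threeTorsionCheck a₁ a₂ a₃ a₄ a₆ k cert = some 1) :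
    Nat.card {Q : (W.baseChange ℚ_[3]).toAffine.Point // (3 : ℕ) • Q = 0} = 3 ^ 1 := by
  rw [natCard_threeTorsion_eq_of_intModel_of_check a₁ a₂ a₃ a₄ a₆ W hI h]; norm_num

end Main

end Summit.BirchSwinnertonDyer.Rank1Residual.GaloisImage.LocalTorsion3

end
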